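import Mathlib
import Summits.AtomisticToContinuum.HydrodynamicLimit.Theses.OneFlightGossipEngine
import Literature.Analysis.FluidPDE.HardSphereCollisionRecord

/-!
# Crux-ideate sketch — `SuperExponentialEnergyTails` (stmt-AtomisticToContinuum-17701), round 1, ideator 1

First lemmas of the two idea cards filed by `planner-cruxidea-stmt-AtomisticToContinuum-17701-1-0`:

* §1 card `seet-rides-gaussian-census`: the Gaussian level census in the SEET frame
  (`GaussianCensusInSeetFrame`, C⁺) and the layer-cake transfer `seet_of_gaussianCensus` (signature);
  the growth dichotomy behind "the rate is the sweep": a thermal-rate destruction floor closes the moment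
  hierarchy only at `(p!)²` (`sq_factorial_growth`), a sweeping-rate floor at `p!` (`factorial_growth`) — both PROVED.
* §2 card `anchored-tilt-transfer`: the Bayes transfer of a RELATIVE conditional-uniformity statement under an
  almost-`m`-measurable exponential tilt (`relative_uniformity_transfer`, signature) and the ANCHORED coarse-past
  σ-algebra (`anchoredPastSigma`) over `HardSphereCollisionRecord`.

Nothing here is a route item; sorries mark signatures only.
-/

noncomputable section

open scoped BigOperators ENNReal Classical
open MeasureTheory Set Filter
open Literature.MathematicalPhysics.KineticTheory Literature.Analysis.FluidPDE

namespace Summit.AtomisticToContinuum.HydrodynamicLimit.Cruxes.SuperExponentialEnergyTails.IdeatorOneRound1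

/-! ## §1 `seet-rides-gaussian-census` -/

/-- **Gaussian level census in the SEET frame** (C⁺ of card `seet-rides-gaussian-census`): under the SEET
prefix (continuous profiles, `∃ σ₀ ∀ σ < σ₀`, classical hs-Euler solution on `[0,T)`, flow family, LLN tie at
`t = 0`, `t < T`) there are `α, B, E₀ > 0` and `N₀` such that for all `N ≥ N₀`, `s ∈ [0,t]`, `E ≥ E₀` the EXPECTED
NUMBER of spheres with kinetic energy above level `E` is at most `B (N+1) e^{-α E}` — the terminal statement
`GaussianCensusBound` of line `level-census-comparison` (crux EnergyCurrentTails, stmt-9235) moved under this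
crux's prefix. -/
def GaussianCensusInSeetFrame : Prop :=
  ∀ (a₀ θ₀ : T3 → ℝ) (u₀ : T3 → V3), Continuous a₀ → Continuous θ₀ → Continuous u₀ → (∀ x, 0 < a₀ x) →
    (∀ x, 0 < θ₀ x) → ∃ σ₀ : ℝ, 0 < σ₀ ∧ ∀ σ : ℝ, 0 < σ → σ < σ₀ →
    ∀ (T : ℝ) (ρ θ : ℝ → T3 → ℝ) (u : ℝ → T3 → V3), IsHardSphereEulerSolution σ T ρ u θ →
    ∀ Φ : (N : ℕ) → HardSphereFlow (Torus.geometry (Fin 3)) (hsDiameter σ N) (N + 1),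
    TendstoHydroFieldsAt (fun N => localGibbsLaw σ a₀ u₀ θ₀ N (Φ N)) Φ ρ u θ 0 →
    ∀ t ∈ Set.Ico 0 T, ∃ α : ℝ, 0 < α ∧ ∃ B : ℝ, 0 < B ∧ ∃ E₀ : ℝ, 0 < E₀ ∧ ∃ N₀ : ℕ, ∀ N : ℕ, N₀ ≤ N →
      ∀ s ∈ Set.Icc 0 t, ∀ E : ℝ, E₀ ≤ E →
        ∫⁻ z, (((Finset.univ.filter fun i : Fin (N + 1) => E < ‖((Φ N).flow s z i).2‖ ^ 2).card : ℕ) : ℝ≥0∞)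
          ∂(localGibbsLaw σ a₀ u₀ θ₀ N (Φ N)) ≤ ENNReal.ofReal (B * ((N : ℝ) + 1) * Real.exp (-(α * E)))

/-- **Layer-cake transfer** (first lemma of the card; signature): the Gaussian census implies SEET for EVERY rate
`c`, with `N₀` the census's and the slack `ε` unused — `‖v‖³ 1{‖v‖ > K} = K³ 1{‖v‖² > K²} + ∫_{K}^{∞} 3r² 1{‖v‖² > r²} dr`,
Tonelli, then `B e^{-αK²}(K³ + 3(K+1)/α + …) ≤ e^{-cK}` for `K ≥ K₀(c, α, B, E₀)`. -/
theorem seet_of_gaussianCensus :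
    GaussianCensusInSeetFrame →
      Summit.AtomisticToContinuum.HydrodynamicLimit.Theses.OneFlightGossipEngine.SuperExponentialEnergyTails := by
  sorry

/-- **Thermal-rate floor ⇒ `(p!)²`.** If a moment hierarchy closes as `y_p ≤ A·p·√(y_{p-1} y_p)` (loss ∝ y_p at the
THERMAL collision rate, gain ∝ p·y_{p-1/2} at the SWEEPING rate, Cauchy–Schwarz on the half step), then
`y_p ≤ y_0 (A²)^p (p!)²` — exponential tails of ONE rate only, i.e. not SEET. [folklore] -/
theorem sq_factorial_growth (y : ℕ → ℝ) (A : ℝ) (hA : 0 ≤ A) (hy : ∀ p, 0 ≤ y p)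
    (hrec : ∀ p : ℕ, 1 ≤ p → y p ≤ A * p * Real.sqrt (y (p - 1) * y p)) :
    ∀ p : ℕ, y p ≤ y 0 * (A ^ 2) ^ p * ((p.factorial : ℝ)) ^ 2 := by
  -- from `y_p ≤ A p √(y_{p-1} y_p)` get `y_p ≤ (A p)² y_{p-1}`, then induct
  have step : ∀ p : ℕ, 1 ≤ p → y p ≤ (A * p) ^ 2 * y (p - 1) := by
    intro p hp
    have h := hrec p hp
    have hyp : 0 ≤ y p := hy p
    have hym : 0 ≤ y (p - 1) := hy (p - 1)
    by_cases hzero : y p = 0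
    · rw [hzero]; positivity
    · have hpos : 0 < y p := lt_of_le_of_ne hyp (Ne.symm hzero)
      -- square both sides of `y p ≤ A p √(y_{p-1} y_p)`
      have hAp : 0 ≤ A * p := by positivity
      have hsq : (y p) ^ 2 ≤ (A * p) ^ 2 * (y (p - 1) * y p) := by
        have h1 : 0 ≤ A * ↑p * Real.sqrt (y (p - 1) * y p) := by positivity
        calc (y p) ^ 2 ≤ (A * p * Real.sqrt (y (p - 1) * y p)) ^ 2 := by
              exact pow_le_pow_left₀ hyp h 2
          _ = (A * p) ^ 2 * (Real.sqrt (y (p - 1) * y p)) ^ 2 := by ring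
          _ = (A * p) ^ 2 * (y (p - 1) * y p) := by
              rw [Real.sq_sqrt (by positivity)]
      -- divide by `y p > 0`
      have : y p * y p ≤ ((A * p) ^ 2 * y (p - 1)) * y p := by nlinarith [hsq]
      exact le_of_mul_le_mul_right this hpos
  intro p
  induction p with
  | zero => simp
  | succ n ih =>
    have hs := step (n + 1) (Nat.succ_le_succ (Nat.zero_le n))
    simp only [Nat.add_sub_cancel] at hs
    calc y (n + 1) ≤ (A * (n + 1 : ℕ)) ^ 2 * y n := hs
      _ ≤ (A * (n + 1 : ℕ)) ^ 2 * (y 0 * (A ^ 2) ^ n * ((n.factorial : ℝ)) ^ 2) := by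
          exact mul_le_mul_of_nonneg_left ih (by positivity)
      _ = y 0 * (A ^ 2) ^ (n + 1) * (((n + 1).factorial : ℝ)) ^ 2 := by
          rw [Nat.factorial_succ]; push_cast; ring

/-- **Sweeping-rate floor ⇒ `p!`.** If the hierarchy closes as `y_p ≤ A·p·y_{p-1}` (loss and gain both at the
sweeping rate `∝ ‖v‖`, so the half powers match), then `y_p ≤ y_0 A^p p!` — the Gaussian growth class, i.e. SEET
(indeed Nachtergaele–Yau's `HighMomentumCutoff` profile). [folklore] -/
theorem factorial_growth (y : ℕ → ℝ) (A : ℝ) (hA : 0 ≤ A) (_hy : ∀ p, 0 ≤ y p)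
    (hrec : ∀ p : ℕ, 1 ≤ p → y p ≤ A * p * y (p - 1)) :
    ∀ p : ℕ, y p ≤ y 0 * A ^ p * (p.factorial : ℝ) := by
  intro p
  induction p with
  | zero => simp
  | succ n ih =>
    have hs := hrec (n + 1) (Nat.succ_le_succ (Nat.zero_le n))
    simp only [Nat.add_sub_cancel] at hs
    calc y (n + 1) ≤ A * (n + 1 : ℕ) * y n := hs
      _ ≤ A * (n + 1 : ℕ) * (y 0 * A ^ n * (n.factorial : ℝ)) := by
          exact mul_le_mul_of_nonneg_left ih (by positivity)
      _ = y 0 * A ^ (n + 1) * ((n + 1).factorial : ℝ) := by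
          rw [Nat.factorial_succ]; push_cast; ring

/-! ## §2 `anchored-tilt-transfer` -/

/-- **Bayes transfer of RELATIVE conditional uniformity under an almost-`m`-measurable tilt** (first lemma of card
`anchored-tilt-transfer`; signature). If under `Q` the event `A` is conditionally uniform at mass `u` given the
sub-σ-algebra `m` up to a relative defect `δ` (set form: `|Q(A ∩ E) − u Q(E)| ≤ δ Q(E)` for all `E ∈ m`), and
`P = e^{R₁+R₂}·Q` with `R₁` `m`-measurable and `|R₂| ≤ η`, then under `P` the same holds with relative defect
`(e^{2η} − 1) u + e^{2η} δ`: the measurable part of the tilt CANCELS, nothing is spent. (Proof: `P(A ∩ E) =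
∫_E e^{R₁} Q[1_A e^{R₂} | m] dQ`, `e^{R₂} ∈ [e^{-η}, e^{η}]`.) [folklore] -/
theorem relative_uniformity_transfer {Ω : Type*} {m m₀ : MeasurableSpace Ω} (hm : m ≤ m₀)
    (Q : Measure Ω) [IsFiniteMeasure Q] (R₁ R₂ : Ω → ℝ) (hR₁ : Measurable[m] R₁) (hR₂m : Measurable R₂)
    (hint : Integrable (fun ω => Real.exp (R₁ ω + R₂ ω)) Q)
    (η : ℝ) (hη : 0 ≤ η) (hR₂ : ∀ ω, |R₂ ω| ≤ η)
    (A : Set Ω) (hA : MeasurableSet A) (u δ : ℝ) (hu : 0 ≤ u) (hδ : 0 ≤ δ)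
    (hQ : ∀ E : Set Ω, MeasurableSet[m] E → |(Q (A ∩ E)).toReal - u * (Q E).toReal| ≤ δ * (Q E).toReal) :
    ∀ E : Set Ω, MeasurableSet[m] E →
      |((Q.withDensity fun ω => ENNReal.ofReal (Real.exp (R₁ ω + R₂ ω))) (A ∩ E)).toReal
          - u * ((Q.withDensity fun ω => ENNReal.ofReal (Real.exp (R₁ ω + R₂ ω))) E).toReal|
        ≤ ((Real.exp (2 * η) - 1) * u + Real.exp (2 * η) * δ)
            * ((Q.withDensity fun ω => ENNReal.ofReal (Real.exp (R₁ ω + R₂ ω))) E).toReal := by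
  sorry

/-- **The ANCHORED coarse past** of the `n`-th collision of sphere `i` along a hard-sphere flow on `𝕋³`: the route's
coarse past (`coarsePastOf`: `r`-cells of ALL positions + exact velocities at the two flight starts) and partner
identity, with the TIME-0 configuration adjoined at resolution `r₀` (cells `Torus.coarseCell r₀`, exact velocities).
With `r₀ = η/(C N)` the log-density `Σₖ φ(xₖ(0), vₖ(0))` of the local Gibbs law against the global one is measurable
w.r.t. this σ-algebra up to a remainder of total oscillation `≤ η (1 + 2 E_tot/N)` — the hypothesis of
`relative_uniformity_transfer`. [folklore] -/
abbrev anchoredPastSigma {σ : ℝ} {N : ℕ}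
    (Φ : HardSphereFlow (Torus.geometry (Fin 3)) (hsDiameter σ N) (N + 1)) (r r₀ : ℝ) (i : Fin (N + 1)) (n : ℕ) :
    MeasurableSpace (Config (N + 1) (Fin 3) T3) :=
  MeasurableSpace.comap
    (fun z => (Φ.coarsePastOf (Torus.coarseCell r) i n z, Φ.nthPartnerOf i n z, coarseConfig (Torus.coarseCell r₀) z))
    inferInstance

/-- **Anchored one-flight angular chaos, RELATIVE form on the energetic projectiles** (the equilibrium statement the
card asks of the engine; informal rendering, global Gibbs law `P` = `localGibbsLaw σ (const a₀) 0 (const θ₀)`):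
for every measurable `B ⊆ S²`-cone of outgoing directions and every `E` in the ANCHORED σ-algebra contained in
`{K ≤ ‖vᵢ‖ at the flight start}`, `|P(W ∩ A_B ∩ E) − u(B) P(W ∩ E)| ≤ δ · P(W ∩ E)` for `N ≥ N₀`, `n ≥ n₀(N) ≍ log N`
(after the scrambling epoch). Typed here only through its σ-algebra; the full text is `OneFlightLayeredChaos`
(stmt-14535) with `coarsePastSigma` replaced by `anchoredPastSigma` and the absolute defect `C σ^p` replaced by the
relative one on `{K ≤ ‖vᵢ‖}`. -/
def AnchoredRelativeChaosShape {σ : ℝ} {N : ℕ}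
    (Φ : HardSphereFlow (Torus.geometry (Fin 3)) (hsDiameter σ N) (N + 1)) (P : Measure (Config (N + 1) (Fin 3) T3))
    (r r₀ δ : ℝ) (i : Fin (N + 1)) (n : ℕ) (W A : Set (Config (N + 1) (Fin 3) T3)) (u : ℝ) : Prop :=
  ∀ E : Set (Config (N + 1) (Fin 3) T3), MeasurableSet[anchoredPastSigma Φ r r₀ i n] E →
    |(P (W ∩ A ∩ E)).toReal - u * (P (W ∩ E)).toReal| ≤ δ * (P (W ∩ E)).toReal

end Summit.AtomisticToContinuum.HydrodynamicLimit.Cruxes.SuperExponentialEnergyTails.IdeatorOneRound1
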